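import Literature.NumberTheory.GaloisRepresentations.CartanNormalizerCriterionGL2Fp
import Literature.NumberTheory.GaloisRepresentations.ResidualGaloisRep
import Literature.NumberTheory.GaloisRepresentations.DecomposedGeneric
import Literature.RepresentationTheory.FiniteGroups.InvariantLineOfFixedVectors
import HarnessLib

/-!
# Caraiani–Newton, Lemma 7.1.1 for homomorphisms `ρ̄ : Γ → GL₂(𝔽_p)`; Lemma 6.1.4; steps of the
# proof of Lemma 6.2.2

Topic `NumberTheory/GaloisRepresentations`; theorems only (no definitions, no named facts).
Companion of `CartanNormalizerCriterionGL2Fp`, which proves Lemma 7.1.1 of A. Caraiani,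
J. Newton, *On the modularity of elliptic curves over imaginary quadratic fields*,
arXiv:2301.10509 [CaraianiNewton2023], §7.1, p. 92, for a subgroup `G ⊆ GL₂(𝔽_p)` under
elementwise hypotheses (`G` fixes no line; the determinant-one elements of `G` have a common
eigenvector over some extension field).  This file transports those results to the printed
shape — a homomorphism `ρ̄ : Γ →* GL₂(𝔽_p)` (for the source, `Γ = G_F`) such that

* the representation of `Γ` on `𝔽_p²` through `ρ̄` is **irreducible** — Mathlib's
  `Representation.IsIrreducible` of the tree's `glRepresentation ρ̄` (`ResidualGaloisRep`);
* the restriction of `ρ̄` to `ker(det ρ̄)` is **not absolutely irreducible** — the tree's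
  `IsAbsIrreducible` (`ResidualGaloisRep`: irreducible after every extension of scalars
  `f : 𝔽_p →+* k'`).  In the source `det ρ̄ = ε̄_p` is the mod-`p` cyclotomic character, so that
  `ker(det ρ̄) = G_{F(ζ_p)}` and this is "`ρ̄|_{G_{F(ζ_p)}}` absolutely reducible"; the identity
  `ρ̄(G_{F(ζ_p)}) = ρ̄(G_F) ∩ SL₂(𝔽_p)` used in the printed proof is then automatic;
* for (3): `det ∘ ρ̄ : Γ → 𝔽₅ˣ` onto ("`[F(ζ₅) : F] = 4`").

## Contents

* `not_range_le_eigenvectorStabilizer` — an irreducible `σ : Γ →* GL₂(k)` fixes no line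
  (`k v` would be a subrepresentation `≠ ⊥, ⊤`);
* `exists_eigenvector_of_not_isAbsIrreducible` — if `σ : Γ →* GL₂(k)` is not absolutely
  irreducible, some extension `f : k →+* L` and `0 ≠ v ∈ L²` have `f(σ γ) v ∈ L v` for all `γ`
  (a `Γ`-stable `L`-line, via the tree's `finrank_eq_one_of_ne_bot_of_ne_top`);
* `range_le_normalizer_cartan` (**Lemma 7.1.1 (1)**, `p` odd),
  `range_eq_normalizer_splitCartan_or_le_unitGroup` (**(2)**, `p = 3`),
  `range_le_normalizer_nonsplitCartan` (**(3)**, `p = 5`) — the three parts for `ρ̄(Γ)`, from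
  `CaraianiNewton.exists_le_normalizer_cartan`, `….eq_normalizer_splitCartan_or_le_unitGroup`,
  `….exists_le_normalizer_nonsplitCartan`;
* `exists_mem_fst_snd_ne_one_not_dvd_orderOf` — the element `τ` of the proof of
  **Lemma 6.2.2** (pp. 90–91): a subgroup `H ⊆ M × M` (`M` finite) with both projections onto,
  where `M` has a non-identity element of order prime to `p` (cf.
  `CaraianiNewton.exists_projective_ne_one_not_dvd_orderOf`), contains an element both of whose
  components are non-identity of order prime to `p` — proved directly (the source uses
  Goursat's lemma, Lemma 6.2.1); with `pow_prime_pow_ne_one`, `not_dvd_orderOf_pow`,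
  `exists_not_dvd_orderOf_pow_prime_pow`;
* `disc_ne_zero_of_projective` — the next step of that proof: an element of `GL₂(𝔽_p)` (`p` odd)
  whose image in `PGL₂(𝔽_p)` is non-identity of order prime to `p` is regular semisimple
  (`disc_ne_zero_of_pow_eq_smul_one`);
* **Lemma 6.1.4** (p. 88, from the proof of [AKT23, Cor. 9.14]) in group form:
  `SL2F5_eq_top_of_sup_center_eq_top` (a subgroup of `SL₂(𝔽₅)` onto `PSL₂(𝔽₅)` is `SL₂(𝔽₅)`,
  by perfectness — Mathlib `Matrix.SL2.commutator_eq_top` — through the general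
  `eq_top_of_sup_eq_top_of_le_center`), `toGL_mem_map_ker_det` (`ρ̄(ker det ρ̄) = SL₂(𝔽₅)` when
  its projective image contains `PSL₂(𝔽₅)`), `exists_projective_eq_one_det_ne_one` (then, if
  `det ρ̄` is non-trivial — "`ζ₅ ∉ F`" — some `γ` has scalar `ρ̄(γ)` of determinant `≠ 1`: "the
  extension cut out by the projective image of `ρ̄(G_F)` does not contain `ζ₅`");
* `isAbsIrreducible_comp_subtype_ker_det` — p. 88: if `ρ̄(Γ) ⊇ SL₂(𝔽_p)` then `ρ̄|_{ker det ρ̄}`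
  is absolutely irreducible.
* `exists_disc_ne_zero_and_disc_apply_ne_zero` — **the group-theoretic heart of Lemma 6.2.2**
  assembled: for `ρ̄ : Γ →* GL₂(𝔽_p)` (`p` odd), an endomorphism `θ` of `Γ` and a subgroup
  `Γ₁` with `θ(Γ₁) = Γ₁` on which `ρ̄` is irreducible (source: `Γ = G_F`, `θ = c⁻¹(·)c`,
  `Γ₁ = G_{F(ζ_p)}`), some `τ ∈ Γ₁` has both `ρ̄(τ)` and `ρ̄(θτ)` regular semisimple — from the
  three lemmas above applied to `H = {(Proj ρ̄(σ), Proj ρ̄(θσ))} ≤ M × M`, `M = Proj ρ̄(Γ₁)`, with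
  no fixed fields or Galois closures; `nodup_eigenvalueMultiset_of_disc_ne_zero`,
  `eigenvalueMultiset_conj`, `natCast_algebraicClosure_eq_one_of_modEq` and
  `exists_eigenvalue_generic_pair` then phrase the conclusion as the eigenvalue clause of
  "`l` is decomposed generic for `ρ̄`" (`IsGenericAt` of `DecomposedGeneric`, [ACC⁺23, Def. 4.3.1])
  for every `l ≡ 1 mod p` and every conjugate of `ρ̄(τ)`, `ρ̄(θτ)`.  The remaining, number-theoretic
  step of the printed proof (Chebotarev, through the tree's proved
  `Literature.NumberTheory.Automorphic.chebotarev_artinRep_holds`; Frobenius bookkeeping at the split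
  primes) is carried out in `GaloisRepresentations/DecomposedGenericOfQuadratic`, which proves
  Lemma 6.2.2 in full.

## References

* [CaraianiNewton2023] A. Caraiani, J. Newton, arXiv:2301.10509v3, §6.1 (p. 88: the `100%`
  remark and Lemma 6.1.4 with its proof), §6.2 (Lemmas 6.2.1–6.2.2 and the proof of Lemma 6.2.2,
  pp. 90–91), §7.1 (Lemma 7.1.1 and its proof, p. 92) (read 2026-08-15,
  `lit read arxiv:2301.10509`).
-/

namespace Literature.NumberTheory.GaloisRepresentations.CaraianiNewton

open Matrix
open scoped MatrixGroups

universe uΓ w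

variable {Γ : Type uΓ} [Group Γ]

/-! ### From Mathlib irreducibility / the tree's absolute irreducibility to eigenvectors -/

/-- **An irreducible `GL₂`-valued homomorphism fixes no line**: if the representation of `Γ` on
`k²` through `σ : Γ →* GL₂(k)` is irreducible (Mathlib `Representation.IsIrreducible`), then for
every `v ≠ 0` some `σ(γ)` moves the line `k v` — otherwise `k v` would be a subrepresentation
which is neither `⊥` nor `⊤`. [folklore] -/
theorem not_range_le_eigenvectorStabilizer {k : Type w} [Field k] (σ : Γ →* GL (Fin 2) k)
    (hirr : (glRepresentation σ).IsIrreducible) (v : Fin 2 → k) (hv : v ≠ 0) :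
    ¬ σ.range ≤ eigenvectorStabilizer v hv := by
  intro hle
  let W : Subrepresentation (glRepresentation σ) :=
    { toSubmodule := Submodule.span k {v}
      apply_mem_toSubmodule := fun g x hx ↦ by
        obtain ⟨a, rfl⟩ := Submodule.mem_span_singleton.mp hx
        obtain ⟨c, hc⟩ := mem_eigenvectorStabilizer_iff.mp (hle ⟨g, rfl⟩)
        rw [map_smul, glRepresentation_apply_apply, hc, smul_smul]
        exact Submodule.smul_mem _ _ (Submodule.mem_span_singleton_self v) }
  have h2 : Module.finrank k (Fin 2 → k) = 2 := Module.finrank_fin_fun k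
  have hW := Literature.RepresentationTheory.FiniteGroups.Representation.ne_bot_and_ne_top_of_finrank_eq_one
    h2 (finrank_span_singleton hv)
  rcases hirr.eq_bot_or_eq_top W with h | h
  · exact hW.1 (congrArg Subrepresentation.toSubmodule h)
  · exact hW.2 (congrArg Subrepresentation.toSubmodule h)

/-- **A `GL₂`-valued homomorphism which is not absolutely irreducible has a common eigenvector
after extension of scalars**: if `σ : Γ →* GL₂(k)` is not `IsAbsIrreducible`, there are a field
`L`, `f : k →+* L` and `0 ≠ v ∈ L²` with `f(σ γ) v ∈ L v` for all `γ` (a `Γ`-stable `L`-line of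
`L²` is spanned by any of its non-zero vectors). [folklore] -/
theorem exists_eigenvector_of_not_isAbsIrreducible {k : Type w} [Field k] (σ : Γ →* GL (Fin 2) k)
    (h : ¬ IsAbsIrreducible σ) :
    ∃ (L : Type w) (_ : Field L) (f : k →+* L) (v : Fin 2 → L), v ≠ 0 ∧
      ∀ γ : Γ, ∃ c : L, ((σ γ : Matrix (Fin 2) (Fin 2) k).map f) *ᵥ v = c • v := by
  classical
  unfold IsAbsIrreducible at h
  push Not at h
  obtain ⟨L, _, f, hnot⟩ := h
  set ρL := glRepresentation ((Matrix.GeneralLinearGroup.map f).comp σ) with hρL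
  have h2 : Module.finrank L (Fin 2 → L) = 2 := Module.finrank_fin_fun L
  -- a subrepresentation which is neither `⊥` nor `⊤`
  obtain ⟨W, hWb, hWt⟩ : ∃ W : Subrepresentation ρL, W ≠ ⊥ ∧ W ≠ ⊤ := by
    by_contra! hall
    apply hnot
    have hbt : (⊥ : Subrepresentation ρL) ≠ ⊤ := by
      intro hbt
      have h' : (⊥ : Submodule L (Fin 2 → L)) = ⊤ := congrArg Subrepresentation.toSubmodule hbt
      exact bot_ne_top h'
    exact { toNontrivial := ⟨⟨⊥, ⊤, hbt⟩⟩
            eq_bot_or_eq_top := fun W ↦ by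
              by_cases hb : W = ⊥
              · exact Or.inl hb
              · exact Or.inr (hall W hb) }
  set M : Submodule L (Fin 2 → L) := W.toSubmodule with hM
  have hMb : M ≠ ⊥ := fun h ↦ hWb (Subrepresentation.toSubmodule_injective h)
  have hMt : M ≠ ⊤ := fun h ↦ hWt (Subrepresentation.toSubmodule_injective h)
  have hM1 : Module.finrank L M = 1 :=
    Literature.RepresentationTheory.FiniteGroups.Representation.finrank_eq_one_of_ne_bot_of_ne_top
      h2 hMb hMt
  obtain ⟨w, hwM, hw0⟩ : ∃ w ∈ M, w ≠ 0 := Submodule.exists_mem_ne_zero_of_ne_bot hMb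
  have hspan : Submodule.span L {w} = M :=
    Literature.RepresentationTheory.FiniteGroups.Representation.eq_of_finrank_eq_one_of_mem
      (finrank_span_singleton hw0) hM1 hw0 (Submodule.mem_span_singleton_self _) hwM
  refine ⟨L, inferInstance, f, w, hw0, fun γ ↦ ?_⟩
  have hstab : ((σ γ : Matrix (Fin 2) (Fin 2) k).map f) *ᵥ w ∈ M := by
    have e : ρL γ w = ((σ γ : Matrix (Fin 2) (Fin 2) k).map f) *ᵥ w := rfl
    have := W.apply_mem_toSubmodule γ hwM
    rw [e] at this
    exact this
  rw [← hspan] at hstab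
  obtain ⟨c, hc⟩ := Submodule.mem_span_singleton.mp hstab
  exact ⟨c, hc.symm⟩

/-! ### Lemma 7.1.1 for `ρ̄ : Γ → GL₂(𝔽_p)` -/

section Prime

variable {p : ℕ} [Fact p.Prime]

/-- The group-level hypothesis `hred` of `exists_le_normalizer_cartan` for `G = ρ̄(Γ)`, from
"`ρ̄` restricted to `ker(det ρ̄)` is not absolutely irreducible". [folklore] -/
theorem hred_of_not_isAbsIrreducible (ρ : Γ →* GL (Fin 2) (ZMod p))
    (hred : ¬ IsAbsIrreducible
      (ρ.comp ((Matrix.GeneralLinearGroup.det : GL (Fin 2) (ZMod p) →* (ZMod p)ˣ).comp ρ).ker.subtype)) :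
    ∃ (L : Type) (_ : Field L) (f : ZMod p →+* L) (v : Fin 2 → L), v ≠ 0 ∧
      ∀ g ∈ ρ.range, Matrix.GeneralLinearGroup.det g = 1 →
        ∃ c : L, ((g : Matrix (Fin 2) (Fin 2) (ZMod p)).map f) *ᵥ v = c • v := by
  obtain ⟨L, _, f, v, hv, hL⟩ := exists_eigenvector_of_not_isAbsIrreducible _ hred
  refine ⟨L, inferInstance, f, v, hv, ?_⟩
  rintro g ⟨γ, rfl⟩ hdet
  exact hL ⟨γ, by rw [MonoidHom.mem_ker, MonoidHom.comp_apply]; exact hdet⟩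

/-- **Caraiani–Newton, Lemma 7.1.1 (1), for a homomorphism** (`p` odd). Let
`ρ̄ : Γ → GL₂(𝔽_p)` be such that the representation of `Γ` on `𝔽_p²` through `ρ̄` is
irreducible (Mathlib `Representation.IsIrreducible`) while the restriction of `ρ̄` to
`ker(det ρ̄)` is not absolutely irreducible (tree `IsAbsIrreducible`).  Then `ρ̄(Γ)` is contained
in the normaliser of a Cartan subgroup of `GL₂(𝔽_p)`.  For `Γ = G_F` and `det ρ̄ = ε̄_p` the
mod-`p` cyclotomic character, `ker(det ρ̄) = G_{F(ζ_p)}`, which is the printed form.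
[cite: CaraianiNewton2023, Lemma 7.1.1 (1)] -/
theorem range_le_normalizer_cartan (hp2 : p ≠ 2) (ρ : Γ →* GL (Fin 2) (ZMod p))
    (hirr : (glRepresentation ρ).IsIrreducible)
    (hred : ¬ IsAbsIrreducible
      (ρ.comp ((Matrix.GeneralLinearGroup.det : GL (Fin 2) (ZMod p) →* (ZMod p)ˣ).comp ρ).ker.subtype)) :
    ∃ C ∈ Serre1972.cartanSubgroups (ZMod p),
      ρ.range ≤ Subgroup.normalizer (C : Set (GL (Fin 2) (ZMod p))) :=
  exists_le_normalizer_cartan hp2 ρ.range (not_range_le_eigenvectorStabilizer ρ hirr)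
    (hred_of_not_isAbsIrreducible ρ hred)

/-- **Caraiani–Newton, Lemma 7.1.1 (2), for a homomorphism** (`p = 3`): under the hypotheses
of `range_le_normalizer_cartan`, `ρ̄(Γ)` is the normaliser `C_s⁺(3)` of a split Cartan
subgroup, or lies in a non-split Cartan subgroup `C_ns(3) = kˣ`.
[cite: CaraianiNewton2023, Lemma 7.1.1 (2)] -/
theorem range_eq_normalizer_splitCartan_or_le_unitGroup (ρ : Γ →* GL (Fin 2) (ZMod 3))
    (hirr : (glRepresentation ρ).IsIrreducible)
    (hred : ¬ IsAbsIrreducible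
      (ρ.comp ((Matrix.GeneralLinearGroup.det : GL (Fin 2) (ZMod 3) →* (ZMod 3)ˣ).comp ρ).ker.subtype)) :
    (∃ P : GL (Fin 2) (ZMod 3),
        ρ.range = Subgroup.normalizer (Serre1972.splitCartan P : Set (GL (Fin 2) (ZMod 3)))) ∨
      ∃ k : Subalgebra (ZMod 3) (Matrix (Fin 2) (Fin 2) (ZMod 3)), IsField k ∧
        Module.finrank (ZMod 3) k = 2 ∧ ρ.range ≤ Serre1972.unitGroup k :=
  eq_normalizer_splitCartan_or_le_unitGroup ρ.range (not_range_le_eigenvectorStabilizer ρ hirr)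
    (hred_of_not_isAbsIrreducible ρ hred)

/-- **Caraiani–Newton, Lemma 7.1.1 (3), for a homomorphism** (`p = 5`): under the hypotheses
of `range_le_normalizer_cartan` and if `det ∘ ρ̄ : Γ → 𝔽₅ˣ` is onto (for `det ρ̄ = ε̄₅`:
`[F(ζ₅) : F] = 4`), `ρ̄(Γ)` lies in the normaliser `C_ns⁺(5)` of a non-split Cartan subgroup.
[cite: CaraianiNewton2023, Lemma 7.1.1 (3)] -/
theorem range_le_normalizer_nonsplitCartan [Fact (Nat.Prime 5)] (ρ : Γ →* GL (Fin 2) (ZMod 5))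
    (hirr : (glRepresentation ρ).IsIrreducible)
    (hred : ¬ IsAbsIrreducible
      (ρ.comp ((Matrix.GeneralLinearGroup.det : GL (Fin 2) (ZMod 5) →* (ZMod 5)ˣ).comp ρ).ker.subtype))
    (hdet : Function.Surjective
      ((Matrix.GeneralLinearGroup.det : GL (Fin 2) (ZMod 5) →* (ZMod 5)ˣ).comp ρ)) :
    ∃ k : Subalgebra (ZMod 5) (Matrix (Fin 2) (Fin 2) (ZMod 5)), IsField k ∧
      Module.finrank (ZMod 5) k = 2 ∧
      ρ.range ≤ Subgroup.normalizer (Serre1972.unitGroup k : Set (GL (Fin 2) (ZMod 5))) :=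
  exists_le_normalizer_nonsplitCartan ρ.range (not_range_le_eigenvectorStabilizer ρ hirr)
    (hred_of_not_isAbsIrreducible ρ hred) fun u ↦ by
      obtain ⟨γ, hγ⟩ := hdet u
      exact ⟨ρ γ, ⟨γ, rfl⟩, hγ⟩

end Prime


/-! ### Lemma 6.2.2 (proof): the element `τ` with both projections of order prime to `p` -/

section Tau

variable {M : Type*} [Group M]

/-- A non-identity element of order prime to `p` stays non-identity under `p`-power maps.
[folklore] -/
theorem pow_prime_pow_ne_one {p : ℕ} [hp : Fact p.Prime] {T : M} (hT1 : T ≠ 1)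
    (hTp : ¬ p ∣ orderOf T) (b : ℕ) : T ^ p ^ b ≠ 1 := by
  intro h
  have hdvd : orderOf T ∣ p ^ b := orderOf_dvd_of_pow_eq_one h
  have hcop : Nat.Coprime (orderOf T) (p ^ b) :=
    Nat.Coprime.pow_right b ((Nat.Prime.coprime_iff_not_dvd hp.out).mpr hTp).symm
  have h1 : orderOf T = 1 := Nat.Coprime.eq_one_of_dvd hcop hdvd
  exact hT1 (orderOf_eq_one_iff.mp h1)

/-- Powers of an element of order prime to `p` have order prime to `p`. [folklore] -/
theorem not_dvd_orderOf_pow {p : ℕ} {T : M} (hTp : ¬ p ∣ orderOf T) (k : ℕ) :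
    ¬ p ∣ orderOf (T ^ k) := fun h ↦ hTp (h.trans (orderOf_pow_dvd k))

/-- In a finite group, a suitable `p`-power of any element has order prime to `p` (write
`ord T' = pᵇ m`, `p ∤ m`; then `(T'^{pᵇ})^m = 1`). [folklore] -/
theorem exists_not_dvd_orderOf_pow_prime_pow [Finite M] {p : ℕ} [hp : Fact p.Prime] (T' : M) :
    ∃ b : ℕ, ¬ p ∣ orderOf (T' ^ p ^ b) := by
  obtain ⟨b, m, hm, hn⟩ :=
    Nat.exists_eq_pow_mul_and_not_dvd (orderOf_pos T').ne' p hp.out.one_lt.ne'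
  refine ⟨b, fun h ↦ hm (h.trans (orderOf_dvd_of_pow_eq_one ?_))⟩
  rw [← pow_mul, ← hn, pow_orderOf_eq_one]

/-- **From the proof of Caraiani–Newton, Lemma 6.2.2: the element `τ`.** Let `H` be a subgroup
of `M × M` (`M` finite) both of whose projections to `M` are onto, and suppose `M` has a
non-identity element `T` of order prime to `p`.  Then `H` contains an element both of whose
components are non-identity elements of order prime to `p`.  (Source, for
`H = Gal(L̃₁/F(ζ_p)) ↪ Gal(L₁/F(ζ_p)) × Gal(L₁/F(ζ_p)) = M × M`: "We are going to show that there
is an element `τ ∈ Gal(L̃₁/F(ζ_p))` whose image under each projection map to `Gal(L₁/F(ζ_p))`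
is a non-identity element of order prime to `p`", proved there with Goursat's lemma.  Proof
here, without Goursat: lift `T` to `(T, T') ∈ H` and raise to the power `pᵇ` killing the
`p`-part of `T'`; if `T'^{pᵇ} = 1` this gives `(S, 1) ∈ H` with `S ≠ 1` of order prime to
`p`; symmetrically either we are done or `(1, S') ∈ H`, and then `(S, S') ∈ H`.)
[cite: CaraianiNewton2023, Lemma 6.2.2 (proof)] -/
theorem exists_mem_fst_snd_ne_one_not_dvd_orderOf [Finite M] {p : ℕ} [hp : Fact p.Prime]
    (H : Subgroup (M × M)) (h₁ : ∀ x : M, ∃ h ∈ H, h.1 = x) (h₂ : ∀ y : M, ∃ h ∈ H, h.2 = y)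
    {T : M} (hT1 : T ≠ 1) (hTp : ¬ p ∣ orderOf T) :
    ∃ h ∈ H, h.1 ≠ 1 ∧ h.2 ≠ 1 ∧ ¬ p ∣ orderOf h.1 ∧ ¬ p ∣ orderOf h.2 := by
  -- from the first projection: `(A, B) ∈ H`, `A ≠ 1`, both of order prime to `p`
  obtain ⟨x, hxH, hx1⟩ := h₁ T
  obtain ⟨b, hb⟩ := exists_not_dvd_orderOf_pow_prime_pow (p := p) x.2
  have hxb : x ^ p ^ b ∈ H := H.pow_mem hxH _
  have hA1 : (x ^ p ^ b).1 ≠ 1 := by rw [Prod.pow_fst, hx1]; exact pow_prime_pow_ne_one hT1 hTp b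
  have hAp : ¬ p ∣ orderOf (x ^ p ^ b).1 := by rw [Prod.pow_fst, hx1]; exact not_dvd_orderOf_pow hTp _
  have hBp : ¬ p ∣ orderOf (x ^ p ^ b).2 := by rw [Prod.pow_snd]; exact hb
  by_cases hB1 : (x ^ p ^ b).2 ≠ 1
  · exact ⟨x ^ p ^ b, hxb, hA1, hB1, hAp, hBp⟩
  push Not at hB1
  -- from the second projection: `(B', A') ∈ H`, `A' ≠ 1`, both of order prime to `p`
  obtain ⟨y, hyH, hy2⟩ := h₂ T
  obtain ⟨b', hb'⟩ := exists_not_dvd_orderOf_pow_prime_pow (p := p) y.1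
  have hyb : y ^ p ^ b' ∈ H := H.pow_mem hyH _
  have hA'1 : (y ^ p ^ b').2 ≠ 1 := by rw [Prod.pow_snd, hy2]; exact pow_prime_pow_ne_one hT1 hTp b'
  have hA'p : ¬ p ∣ orderOf (y ^ p ^ b').2 := by
    rw [Prod.pow_snd, hy2]; exact not_dvd_orderOf_pow hTp _
  have hB'p : ¬ p ∣ orderOf (y ^ p ^ b').1 := by rw [Prod.pow_fst]; exact hb'
  by_cases hB'1 : (y ^ p ^ b').1 ≠ 1
  · exact ⟨y ^ p ^ b', hyb, hB'1, hA'1, hB'p, hA'p⟩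
  push Not at hB'1
  -- `(A, 1) (1, A') = (A, A')`
  refine ⟨x ^ p ^ b * y ^ p ^ b', H.mul_mem hxb hyb, ?_, ?_, ?_, ?_⟩
  · rw [Prod.fst_mul, hB'1, mul_one]; exact hA1
  · rw [Prod.snd_mul, hB1, one_mul]; exact hA'1
  · rw [Prod.fst_mul, hB'1, mul_one]; exact hAp
  · rw [Prod.snd_mul, hB1, one_mul]; exact hA'p

end Tau


/-! ### Lemma 6.2.2 (proof): elements of `PGL₂`-order prime to `p` are regular semisimple -/

section RegularSemisimple

/-- A non-scalar invertible `2 × 2` matrix some power `g^m` of which, `m` prime to the (odd)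
characteristic, is a **scalar** has non-zero discriminant `tr² - 4 det`, i.e. distinct
eigenvalues (variant of `DeligneSerre1974.TwoByTwo.disc_ne_zero_of_pow_eq_one`, same proof: if
the discriminant vanished, `g = c + N` with `N² = 0`, `N ≠ 0`, and `g^m = c^m + m c^{m-1} N`
is not scalar). [folklore] -/
theorem disc_ne_zero_of_pow_eq_smul_one {K : Type*} [Field K] {g : Matrix (Fin 2) (Fin 2) K}
    (h2 : (2 : K) ≠ 0) (hns : ∀ c : K, g ≠ c • 1) (hdet : g.det ≠ 0) {m : ℕ} (hm : (m : K) ≠ 0)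
    {u : K} (hgm : g ^ m = u • 1) : g.trace ^ 2 - 4 * g.det ≠ 0 := by
  intro hdisc
  set c : K := g.trace / 2 with hc
  set N : Matrix (Fin 2) (Fin 2) K := g - c • (1 : Matrix (Fin 2) (Fin 2) K) with hN
  have hg : g = c • (1 : Matrix (Fin 2) (Fin 2) K) + N := by rw [hN]; abel
  have htr : g.trace = c + c := by rw [hc]; field_simp; ring
  have hdet' : g.det = c * c := by
    have h4 : (4 : K) * g.det = g.trace ^ 2 := by linear_combination -hdisc
    rw [hc]
    field_simp
    linear_combination h4
  have hNN : N * N = 0 := by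
    have h := DeligneSerre1974.TwoByTwo.mul_self_eq g
    rw [hN]
    simp only [sub_mul, mul_sub, smul_mul_assoc, mul_smul_comm, one_mul, mul_one, h]
    rw [hdet', htr]
    module
  have key := DeligneSerre1974.TwoByTwo.smul_pow_smul_one_add c hNN m
  rw [← hg, hgm, smul_smul] at key
  -- `key : (c * u) • 1 = c ^ (m + 1) • 1 + (m c^m) • N`
  have key' : ((m : K) * c ^ m) • N = (c * u - c ^ (m + 1)) • (1 : Matrix (Fin 2) (Fin 2) K) := by
    rw [sub_smul, key]; abel
  by_cases hmc : (m : K) * c ^ m = 0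
  · have hc0 : c = 0 := by
      rcases mul_eq_zero.mp hmc with h | h
      · exact absurd h hm
      · exact pow_eq_zero_iff (n := m) (by rintro rfl; simp at hm) |>.mp h
    apply hdet
    rw [hdet', hc0, mul_zero]
  · -- `N` is a scalar `t` with `t² = 0`, so `N = 0` and `g` is scalar
    set t : K := (c * u - c ^ (m + 1)) / ((m : K) * c ^ m) with ht
    have hNt : N = t • (1 : Matrix (Fin 2) (Fin 2) K) := by
      rw [ht, div_eq_inv_mul, ← smul_smul, ← key', smul_smul, inv_mul_cancel₀ hmc, one_smul]
    have ht0 : t = 0 := by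
      have h := hNN
      rw [hNt, smul_mul_smul_comm, mul_one, ← sq] at h
      have h00 := congrFun (congrFun h 0) 0
      simpa using h00
    apply hns c
    rw [hg, hNt, ht0, zero_smul, add_zero]

variable {p : ℕ} [Fact p.Prime]

/-- **From the proof of Caraiani–Newton, Lemma 6.2.2** ("`ρ̄(τ)` and `ρ̄(c⁻¹τc)` have image in
`PGL₂(𝔽_p)` a non-identity element of order prime to `p`. It follows that they are both regular
semisimple elements of `GL₂(𝔽_p)`"): for `p` odd, an element of `GL₂(𝔽_p)` whose image in
`PGL₂(𝔽_p)` is a non-identity element of order prime to `p` has distinct eigenvalues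
(`tr² - 4 det ≠ 0`). [cite: CaraianiNewton2023, Lemma 6.2.2 (proof)] -/
theorem disc_ne_zero_of_projective (hp2 : p ≠ 2) {g : GL (Fin 2) (ZMod p)}
    (hg1 : Matrix.ProjGenLinGroup.mk g ≠ 1) (hgp : ¬ p ∣ orderOf (Matrix.ProjGenLinGroup.mk g)) :
    (g : Matrix (Fin 2) (Fin 2) (ZMod p)).trace ^ 2 -
      4 * (g : Matrix (Fin 2) (Fin 2) (ZMod p)).det ≠ 0 := by
  have htwo : (2 : ZMod p) ≠ 0 := DeligneSerre1974.two_ne_zero_of_ne_two hp2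
  -- `g` is non-scalar
  have hns : ∀ c : ZMod p, (g : Matrix (Fin 2) (Fin 2) (ZMod p)) ≠ c • 1 := by
    intro c hc
    apply hg1
    have hc0 : c ≠ 0 := by
      intro h0
      apply GL2.det_ne_zero g
      rw [hc, h0, zero_smul, Matrix.det_zero]
    rw [Matrix.ProjGenLinGroup.mk_eq_one, Matrix.GeneralLinearGroup.center_eq_range_scalar]
    refine ⟨Units.mk0 c hc0, Units.ext ?_⟩
    rw [Matrix.GeneralLinearGroup.coe_scalar, Matrix.scalar_apply, hc, Matrix.smul_one_eq_diagonal]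
    rfl
  -- `g^m` is a scalar for `m` the order of the image of `g` in `PGL₂`
  set m : ℕ := orderOf (Matrix.ProjGenLinGroup.mk g) with hm
  have hgm : g ^ m ∈ Subgroup.center (GL (Fin 2) (ZMod p)) := by
    rw [← Matrix.ProjGenLinGroup.mk_eq_one, map_pow, hm, pow_orderOf_eq_one]
  rw [Matrix.GeneralLinearGroup.center_eq_range_scalar] at hgm
  obtain ⟨u, hu⟩ := hgm
  have hgm' : (g : Matrix (Fin 2) (Fin 2) (ZMod p)) ^ m = (u : ZMod p) • 1 := by
    rw [← Units.val_pow_eq_pow_val, ← hu, Matrix.GeneralLinearGroup.coe_scalar, Matrix.scalar_apply,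
      Matrix.smul_one_eq_diagonal]
  have hmK : ((m : ℕ) : ZMod p) ≠ 0 := by
    rw [Ne, ZMod.natCast_eq_zero_iff]
    exact hgp
  exact disc_ne_zero_of_pow_eq_smul_one htwo hns (GL2.det_ne_zero g) hmK hgm'

end RegularSemisimple


/-! ### Lemma 6.1.4 (proof) and p. 88: subgroups of `SL₂(𝔽₅)` onto `PSL₂(𝔽₅)`; `ζ₅` and the
projective image; big image implies absolute irreducibility on `ker det` -/

section PerfectGroups

variable {M : Type*} [Group M]

/-- **A subgroup supplemented by a central subgroup in a perfect group is everything**: if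
`H ⊔ Z = ⊤` with `Z` central and `M` equals its commutator subgroup, then `H = ⊤` (every element
is `h z`; so `H` is normal and every commutator `⁅h₁z₁, h₂z₂⁆ = ⁅h₁, h₂⁆` lies in `H`).
[folklore] -/
theorem eq_top_of_sup_eq_top_of_le_center {H Z : Subgroup M} (hZ : Z ≤ Subgroup.center M)
    (hsup : H ⊔ Z = ⊤) (hcomm : commutator M = ⊤) : H = ⊤ := by
  have hcen : ∀ z ∈ Z, ∀ x : M, x * z = z * x := fun z hz x ↦ Subgroup.mem_center_iff.mp (hZ hz) x
  haveI hZn : Z.Normal := ⟨fun z hz g ↦ by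
    rw [show g * z * g⁻¹ = z by rw [hcen z hz g, mul_inv_cancel_right]]
    exact hz⟩
  have hdec : ∀ g : M, ∃ h ∈ H, ∃ z ∈ Z, g = h * z := by
    intro g
    have hg : g ∈ ((H ⊔ Z : Subgroup M) : Set M) := by rw [hsup]; exact Subgroup.mem_top g
    rw [Subgroup.mul_normal] at hg
    obtain ⟨h, hh, z, hz, rfl⟩ := Set.mem_mul.mp hg
    exact ⟨h, hh, z, hz, rfl⟩
  have hle : commutator M ≤ H := by
    rw [commutator_def, Subgroup.commutator_le]
    intro a _ b _
    rw [commutatorElement_def]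
    obtain ⟨h₁, hh₁, z₁, hz₁, rfl⟩ := hdec a
    obtain ⟨h₂, hh₂, z₂, hz₂, rfl⟩ := hdec b
    have key : h₁ * z₁ * (h₂ * z₂) * (h₁ * z₁)⁻¹ * (h₂ * z₂)⁻¹ = h₁ * h₂ * h₁⁻¹ * h₂⁻¹ := by
      have e1 : h₁ * z₁ * (h₂ * z₂) * (h₁ * z₁)⁻¹ = h₁ * (h₂ * z₂) * h₁⁻¹ := by
        rw [_root_.mul_inv_rev, show h₁ * z₁ * (h₂ * z₂) * (z₁⁻¹ * h₁⁻¹) =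
          h₁ * (z₁ * (h₂ * z₂) * z₁⁻¹) * h₁⁻¹ by group, ← hcen z₁ hz₁, mul_inv_cancel_right]
      rw [e1, _root_.mul_inv_rev, show h₁ * (h₂ * z₂) * h₁⁻¹ * (z₂⁻¹ * h₂⁻¹) =
        h₁ * h₂ * (z₂ * h₁⁻¹ * z₂⁻¹) * h₂⁻¹ by group, ← hcen z₂ hz₂, mul_inv_cancel_right]
    rw [key]
    exact H.mul_mem (H.mul_mem (H.mul_mem hh₁ hh₂) (H.inv_mem hh₁)) (H.inv_mem hh₂)
  rw [hcomm] at hle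
  exact top_le_iff.mp hle

end PerfectGroups

section PSL2F5

/-- Finite checks in `𝔽₅` (before the `Fact (Nat.Prime 5)` variable, so that `decide` sees closed
terms). [folklore] -/
private theorem zmod5_two_ne_zero : (2 : ZMod 5) ≠ 0 := by decide

/-- [folklore] -/
private theorem zmod5_two_sq_ne_one : (2 : ZMod 5) ^ 2 ≠ 1 := by decide

/-- [folklore] -/
private theorem zmod5_two_mul_three' : (2 : ZMod 5) * 3 = 1 := by decide

/-- Squares of non-identity units of `𝔽₅`: `d = -1` or `d² = -1`. [folklore] -/
private theorem zmod5_units_eq_neg_one_or_sq : ∀ d : (ZMod 5)ˣ, d ≠ 1 → d = -1 ∨ d ^ 2 = -1 := by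
  decide

/-- [folklore] -/
private theorem zmod5_two_sq : (2 : ZMod 5) ^ 2 = -1 := by decide

/-- [folklore] -/
private theorem zmod5_units_neg_one_ne_one : (-1 : (ZMod 5)ˣ) ≠ 1 := by decide

variable [Fact (Nat.Prime 5)]

/-- **`SL₂(𝔽₅)` is perfect, so a subgroup supplemented by the centre is everything**: a subgroup
`H ⊆ SL₂(𝔽₅)` with `H · {±1} = SL₂(𝔽₅)` — i.e. mapping onto `PSL₂(𝔽₅)` — equals `SL₂(𝔽₅)`
(Mathlib `Matrix.SL2.commutator_eq_top` with `a = 2`, `a² = 4 ≠ 1`). This is the first sentence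
of the proof of Lemma 6.1.4 of the source: "The group `ρ̄_{E,5}(G_{F(ζ₅)})` is a subgroup of
`SL₂(𝔽₅)` surjecting onto `PSL₂(𝔽₅)`, so it is equal to `SL₂(𝔽₅)`".
[cite: CaraianiNewton2023, Lemma 6.1.4 (proof)] -/
theorem SL2F5_eq_top_of_sup_center_eq_top (H : Subgroup SL(2, ZMod 5))
    (hH : H ⊔ Subgroup.center SL(2, ZMod 5) = ⊤) : H = ⊤ :=
  eq_top_of_sup_eq_top_of_le_center le_rfl hH
    (Matrix.SL2.commutator_eq_top zmod5_two_ne_zero zmod5_two_sq_ne_one)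

/-- **`ρ̄(ker det ρ̄) = SL₂(𝔽₅)` when its projective image contains `PSL₂(𝔽₅)`.** For
`ρ̄ : Γ → GL₂(𝔽₅)`: if for every `s ∈ SL₂(𝔽₅)` some `γ` with `det ρ̄(γ) = 1` has
`ρ̄(γ) ≡ s` in `PGL₂(𝔽₅)`, then every element of `SL₂(𝔽₅)` is a `ρ̄(γ)` with `det ρ̄(γ) = 1`
(`ρ̄(γ) = s · u` with `u` scalar forces `u² = 1`, `u = ±1 ∈ Z(SL₂(𝔽₅))`, and
`SL2F5_eq_top_of_sup_center_eq_top`). [cite: CaraianiNewton2023, Lemma 6.1.4 (proof)] -/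
theorem toGL_mem_map_ker_det (ρ : Γ →* GL (Fin 2) (ZMod 5))
    (hPSL : ∀ s : SL(2, ZMod 5), ∃ γ : Γ, Matrix.GeneralLinearGroup.det (ρ γ) = 1 ∧
      Matrix.ProjGenLinGroup.mk (ρ γ) = Matrix.ProjGenLinGroup.mk (Matrix.SpecialLinearGroup.toGL s))
    (s : SL(2, ZMod 5)) :
    Matrix.SpecialLinearGroup.toGL s ∈
      ((Matrix.GeneralLinearGroup.det : GL (Fin 2) (ZMod 5) →* (ZMod 5)ˣ).comp ρ).ker.map ρ := by
  set Γ' : Subgroup Γ := ((Matrix.GeneralLinearGroup.det : GL (Fin 2) (ZMod 5) →* (ZMod 5)ˣ).comp ρ).ker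
    with hΓ'
  set S' : Subgroup SL(2, ZMod 5) := (Γ'.map ρ).comap Matrix.SpecialLinearGroup.toGL with hS'
  -- `S' ⊔ Z(SL₂) = ⊤`
  have hsup : S' ⊔ Subgroup.center SL(2, ZMod 5) = ⊤ := by
    rw [eq_top_iff]
    intro t _
    obtain ⟨γ, hγdet, hγ⟩ := hPSL t
    obtain ⟨u, hu⟩ := Matrix.ProjGenLinGroup.mk_eq_mk_iff.mp hγ
    -- `u² = 1`
    have hu2 : u ^ 2 = 1 := by
      have h := congrArg Matrix.GeneralLinearGroup.det hu
      rw [map_mul, hγdet, one_mul, Matrix.GeneralLinearGroup.det_scalar, Fintype.card_fin] at h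
      rw [h]
      ext
      rw [Matrix.GeneralLinearGroup.val_det_apply, Matrix.SpecialLinearGroup.coe_GL_coe_matrix,
        t.prop, Units.val_one]
    -- the scalar `u` as an element of `SL₂`, central
    have hcdet : ((u : ZMod 5) • (1 : Matrix (Fin 2) (Fin 2) (ZMod 5))).det = 1 := by
      rw [Matrix.det_smul, Matrix.det_one, mul_one, Fintype.card_fin, ← Units.val_pow_eq_pow_val,
        hu2, Units.val_one]
    set c : SL(2, ZMod 5) := ⟨(u : ZMod 5) • 1, hcdet⟩ with hc
    have hcG : Matrix.SpecialLinearGroup.toGL c = Matrix.GeneralLinearGroup.scalar (Fin 2) u := by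
      apply Units.ext
      rw [Matrix.SpecialLinearGroup.coe_GL_coe_matrix, Matrix.GeneralLinearGroup.coe_scalar,
        Matrix.scalar_apply]
      change (u : ZMod 5) • (1 : Matrix (Fin 2) (Fin 2) (ZMod 5)) = _
      rw [Matrix.smul_one_eq_diagonal]
    have hccen : c ∈ Subgroup.center SL(2, ZMod 5) := by
      rw [Subgroup.mem_center_iff]
      intro g
      apply Subtype.ext
      change (g : Matrix (Fin 2) (Fin 2) (ZMod 5)) * ((u : ZMod 5) • 1) =
        ((u : ZMod 5) • 1) * (g : Matrix (Fin 2) (Fin 2) (ZMod 5))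
      rw [Matrix.mul_smul, Matrix.mul_one, Matrix.smul_mul, Matrix.one_mul]
    -- `ρ γ` as an element of `SL₂`, in `S'`
    have hγdet' : ((ρ γ : GL (Fin 2) (ZMod 5)) : Matrix (Fin 2) (Fin 2) (ZMod 5)).det = 1 := by
      rw [← Matrix.GeneralLinearGroup.val_det_apply, hγdet, Units.val_one]
    set s' : SL(2, ZMod 5) := ⟨((ρ γ : GL (Fin 2) (ZMod 5)) : Matrix (Fin 2) (Fin 2) (ZMod 5)), hγdet'⟩
      with hs'
    have hs'G : Matrix.SpecialLinearGroup.toGL s' = ρ γ := Units.ext rfl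
    have hs'S : s' ∈ S' := by
      rw [hS', Subgroup.mem_comap, hs'G]
      refine Subgroup.mem_map.mpr ⟨γ, ?_, rfl⟩
      rw [hΓ', MonoidHom.mem_ker, MonoidHom.comp_apply]
      exact hγdet
    -- `t = s' c`
    have ht : t = s' * c := by
      apply Matrix.SpecialLinearGroup.toGL_injective
      rw [map_mul, hs'G, hcG, hu]
    rw [ht]
    exact Subgroup.mul_mem_sup hs'S hccen
  have hS'top : S' = ⊤ := SL2F5_eq_top_of_sup_center_eq_top S' hsup
  have hs : s ∈ S' := hS'top ▸ Subgroup.mem_top s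
  rwa [hS', Subgroup.mem_comap] at hs

/-- **Caraiani–Newton, Lemma 6.1.4** (group-theoretic form; the source takes it from the proof
of [AKT23, Cor. 9.14]): "Let `F` be a CM field with `ζ₅ ∉ F` and let `E/F` be an elliptic curve
such that the projective image of `ρ̄_{E,5}(G_{F(ζ₅)})` is conjugate to `PSL₂(𝔽₅)`. Then the
extension of `F` cut out by the projective image of `ρ̄_{E,5}(G_F)` does not contain `ζ₅`."
With `ρ̄ : Γ → GL₂(𝔽₅)`, `det ρ̄ = ε̄₅` (so `G_{F(ζ₅)} = ker det ρ̄`, and "`ζ₅ ∉ F`" reads: `det ρ̄`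
is non-trivial), and `G = ker(Proj ρ̄)`, `H = G ∩ ker det ρ̄`, the conclusion "`H ≠ G`" reads:
some `γ` has scalar `ρ̄(γ)` of determinant `≠ 1`.  Proof (loc. cit., streamlined): by
`toGL_mem_map_ker_det`, `ρ̄(ker det ρ̄) = SL₂(𝔽₅)`; a `γ₁` with `det ρ̄(γ₁) = -1` exists (`d` or
`d²` is `-1` for `1 ≠ d ∈ 𝔽₅ˣ`), then `2·1 · ρ̄(γ₁)⁻¹ ∈ SL₂(𝔽₅)` is some `ρ̄(γ')`, and
`ρ̄(γ'γ₁) = 2·1` is scalar of determinant `4 ≠ 1`. (The source argues with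
`[G : H] = [F(ζ₅) : F] > 1`, resp. `[F(ζ₅) : F] = 4 > [PGL₂(𝔽₅) : PSL₂(𝔽₅)]`.)
[cite: CaraianiNewton2023, Lemma 6.1.4] -/
theorem exists_projective_eq_one_det_ne_one (ρ : Γ →* GL (Fin 2) (ZMod 5))
    (hPSL : ∀ s : SL(2, ZMod 5), ∃ γ : Γ, Matrix.GeneralLinearGroup.det (ρ γ) = 1 ∧
      Matrix.ProjGenLinGroup.mk (ρ γ) = Matrix.ProjGenLinGroup.mk (Matrix.SpecialLinearGroup.toGL s))
    (hdet : ∃ γ : Γ, Matrix.GeneralLinearGroup.det (ρ γ) ≠ 1) :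
    ∃ γ : Γ, Matrix.ProjGenLinGroup.mk (ρ γ) = 1 ∧ Matrix.GeneralLinearGroup.det (ρ γ) ≠ 1 := by
  -- an element of determinant `-1`
  obtain ⟨γ₀, hγ₀⟩ := hdet
  obtain ⟨γ₁, hγ₁⟩ : ∃ γ₁ : Γ, Matrix.GeneralLinearGroup.det (ρ γ₁) = -1 := by
    rcases zmod5_units_eq_neg_one_or_sq _ hγ₀ with h | h
    · exact ⟨γ₀, h⟩
    · exact ⟨γ₀ ^ 2, by rw [map_pow, map_pow, h]⟩
  -- the scalar `2` and `g = 2 · ρ(γ₁)⁻¹ ∈ SL₂(𝔽₅)`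
  set two : (ZMod 5)ˣ := Units.mkOfMulEqOne (2 : ZMod 5) 3 zmod5_two_mul_three' with htwo
  have hdet2 : Matrix.GeneralLinearGroup.det (Matrix.GeneralLinearGroup.scalar (Fin 2) two) = -1 := by
    rw [Matrix.GeneralLinearGroup.det_scalar, Fintype.card_fin]
    ext
    rw [Units.val_pow_eq_pow_val, htwo, Units.val_mkOfMulEqOne, Units.val_neg, Units.val_one]
    exact zmod5_two_sq
  set g : GL (Fin 2) (ZMod 5) := Matrix.GeneralLinearGroup.scalar (Fin 2) two * (ρ γ₁)⁻¹ with hg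
  have hgdet : ((g : GL (Fin 2) (ZMod 5)) : Matrix (Fin 2) (Fin 2) (ZMod 5)).det = 1 := by
    rw [← Matrix.GeneralLinearGroup.val_det_apply, hg, map_mul, map_inv, hdet2, hγ₁, mul_inv_cancel,
      Units.val_one]
  obtain ⟨γ', hγ'Γ, hγ'⟩ := toGL_mem_map_ker_det ρ hPSL ⟨(g : Matrix (Fin 2) (Fin 2) (ZMod 5)), hgdet⟩
  have hγ'g : ρ γ' = g := by rw [hγ']; exact Units.ext rfl
  refine ⟨γ' * γ₁, ?_, ?_⟩
  · rw [map_mul, hγ'g, hg, inv_mul_cancel_right, Matrix.ProjGenLinGroup.mk_scalar]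
  · rw [map_mul, hγ'g, hg, inv_mul_cancel_right, hdet2]
    exact zmod5_units_neg_one_ne_one

end PSL2F5

section BigImage

variable {p : ℕ} [Fact p.Prime]

/-- **Big image implies absolute irreducibility on `ker det`** (source, p. 88: "if the image of
`ρ̄_{E,5}` contains `SL₂(𝔽₅)`, we also have that `ρ̄_{E,5}|_{G_{F(ζ₅)}}` is absolutely
irreducible"): if `SL₂(𝔽_p) = ker det ⊆ ρ̄(Γ)` then the restriction of `ρ̄` to `ker(det ρ̄)` is
absolutely irreducible — its image contains the two elementary transvections, which have no
common eigenvector over any field (`CaraianiNewton.eq_zero_of_transvections_mulVec_eq_smul`).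
[cite: CaraianiNewton2023, §6.1 (proof of the `100%` statement, p. 88)] -/
theorem isAbsIrreducible_comp_subtype_ker_det (ρ : Γ →* GL (Fin 2) (ZMod p))
    (hSL : (Matrix.GeneralLinearGroup.det : GL (Fin 2) (ZMod p) →* (ZMod p)ˣ).ker ≤ ρ.range) :
    IsAbsIrreducible
      (ρ.comp ((Matrix.GeneralLinearGroup.det : GL (Fin 2) (ZMod p) →* (ZMod p)ˣ).comp ρ).ker.subtype) := by
  by_contra h
  obtain ⟨L, _, f, v, hv, hL⟩ := exists_eigenvector_of_not_isAbsIrreducible _ h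
  -- the two elementary transvections are `ρ γ` with `det ρ γ = 1`
  have key : ∀ (x : Matrix (Fin 2) (Fin 2) (ZMod p)) (hx : x.det = 1),
      ∃ a : L, (x.map f) *ᵥ v = a • v := by
    intro x hx
    set xG : GL (Fin 2) (ZMod p) := Matrix.GeneralLinearGroup.mkOfDetNeZero x (by rw [hx]; exact one_ne_zero)
      with hxG
    have hxdet : Matrix.GeneralLinearGroup.det xG = 1 :=
      Units.ext (by rw [Matrix.GeneralLinearGroup.val_det_apply, Units.val_one]; exact hx)
    obtain ⟨γ, hγ⟩ := hSL (show xG ∈ _ by rw [MonoidHom.mem_ker]; exact hxdet)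
    have hγker : γ ∈ ((Matrix.GeneralLinearGroup.det : GL (Fin 2) (ZMod p) →* (ZMod p)ˣ).comp ρ).ker := by
      rw [MonoidHom.mem_ker, MonoidHom.comp_apply, hγ, hxdet]
    obtain ⟨a, ha⟩ := hL ⟨γ, hγker⟩
    refine ⟨a, ?_⟩
    have e : ((ρ.comp (MonoidHom.ker _).subtype) ⟨γ, hγker⟩ : GL (Fin 2) (ZMod p)) = xG := by
      rw [MonoidHom.comp_apply, Subgroup.subtype_apply, hγ]
    rw [e] at ha
    exact ha
  obtain ⟨a, ha⟩ := key !![1, 1; 0, 1] (by simp [Matrix.det_fin_two_of])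
  obtain ⟨b, hb⟩ := key !![1, 0; 1, 1] (by simp [Matrix.det_fin_two_of])
  have hmap₁ : (!![1, 1; 0, 1] : Matrix (Fin 2) (Fin 2) (ZMod p)).map f = !![1, 1; 0, 1] := by
    ext i j; fin_cases i <;> fin_cases j <;> simp
  have hmap₂ : (!![1, 0; 1, 1] : Matrix (Fin 2) (Fin 2) (ZMod p)).map f = !![1, 0; 1, 1] := by
    ext i j; fin_cases i <;> fin_cases j <;> simp
  rw [hmap₁] at ha
  rw [hmap₂] at hb
  exact hv (eq_zero_of_transvections_mulVec_eq_smul ha hb)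

end BigImage

/-! ### Lemma 6.2.2 (proof): the group-theoretic heart — an element `τ ∈ Γ₁` with `ρ̄(τ)` and
`ρ̄(θ τ)` both regular semisimple; eigenvalues -/

section Heart

variable {p : ℕ} [Fact p.Prime]

/-- **The group-theoretic heart of Caraiani–Newton, Lemma 6.2.2** (pp. 90–91), for an abstract
group.  Let `ρ̄ : Γ →* GL₂(𝔽_p)` (`p` odd), `θ : Γ →* Γ` an endomorphism and `Γ₁ ≤ Γ` a subgroup
with `θ(Γ₁) = Γ₁` on which `ρ̄` is irreducible.  Then some `τ ∈ Γ₁` has BOTH `ρ̄(τ)` and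
`ρ̄(θ τ)` regular semisimple (`tr² - 4 det ≠ 0`).  In the source `Γ = G_F` for the quadratic
field `F`, `θ = c⁻¹(·)c` for a lift `c ∈ G_ℚ` of the non-trivial element of `Gal(F/ℚ)`, and
`Γ₁ = G_{F(ζ_p)}` (normal in `G_ℚ`, so `θ(Γ₁) = Γ₁`); the printed argument runs through the
Galois closure `L̃₁` of `L₁ = F̄^{ker Proj ρ̄ ∩ G_{F(ζ_p)}}` over `ℚ` and the embedding
`Gal(L̃₁/F(ζ_p)) ↪ Gal(L₁/F(ζ_p)) × Gal(L₁/F(ζ_p))`, `σ ↦ (σ|_{L₁}, (c⁻¹σc)|_{L₁})`, "whose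
composition with each of the two projection maps … is surjective".  Here, without fixed fields:
`M = Proj ρ̄(Γ₁) ⊆ PGL₂(𝔽_p)` (finite), `H = {(Proj ρ̄(σ), Proj ρ̄(θσ)) : σ ∈ Γ₁} ≤ M × M` has
both projections onto (the second because `θ(Γ₁) = Γ₁`), `M` has a non-identity element of
order prime to `p` (`exists_projective_ne_one_not_dvd_orderOf`: "by Dickson's classification,
or, more simply, [Ser72, Proposition 15]"), so `H` contains `(Proj ρ̄(τ), Proj ρ̄(θτ))` with both
components non-identity of order prime to `p` (`exists_mem_fst_snd_ne_one_not_dvd_orderOf`, the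
Goursat step), and such elements of `GL₂(𝔽_p)` are regular semisimple
(`disc_ne_zero_of_projective`).  What remains of the printed proof after this theorem is number
theory: Chebotarev density (realising the class of `τ` in `Gal(L̃₁/ℚ)` as `Frob_l`, `l ≡ 1 mod p`,
`l` split in `F`), done in `GaloisRepresentations/DecomposedGenericOfQuadratic` with the tree's
proved `chebotarev_artinRep_holds`. [cite: CaraianiNewton2023, Lemma 6.2.2 (proof, pp. 90–91)] -/
theorem exists_disc_ne_zero_and_disc_apply_ne_zero (hp2 : p ≠ 2)
    (ρ : Γ →* GL (Fin 2) (ZMod p)) (θ : Γ →* Γ) (Γ₁ : Subgroup Γ) (hθ : Γ₁.map θ = Γ₁)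
    (hirr : (glRepresentation (ρ.comp Γ₁.subtype)).IsIrreducible) :
    ∃ τ ∈ Γ₁,
      ((ρ τ : GL (Fin 2) (ZMod p)) : Matrix (Fin 2) (Fin 2) (ZMod p)).trace ^ 2 -
          4 * ((ρ τ : GL (Fin 2) (ZMod p)) : Matrix (Fin 2) (Fin 2) (ZMod p)).det ≠ 0 ∧
      ((ρ (θ τ) : GL (Fin 2) (ZMod p)) : Matrix (Fin 2) (Fin 2) (ZMod p)).trace ^ 2 -
          4 * ((ρ (θ τ) : GL (Fin 2) (ZMod p)) : Matrix (Fin 2) (Fin 2) (ZMod p)).det ≠ 0 := by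
  classical
  haveI : Finite (PGL(2, ZMod p)) := Finite.of_surjective _ Matrix.ProjGenLinGroup.mk_surjective
  -- `θ` maps `Γ₁` onto `Γ₁`
  have hθmem : ∀ σ ∈ Γ₁, θ σ ∈ Γ₁ := fun σ hσ ↦ hθ ▸ Subgroup.mem_map_of_mem θ hσ
  have hθsurj : ∀ σ₁ ∈ Γ₁, ∃ σ ∈ Γ₁, θ σ = σ₁ := fun σ₁ hσ₁ ↦ by
    rw [← hθ] at hσ₁
    exact Subgroup.mem_map.1 hσ₁
  -- the projective representation `P = Proj ρ̄` and the finite group `M = P(Γ₁) ⊆ PGL₂(𝔽_p)`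
  set P : Γ →* PGL(2, ZMod p) := Matrix.ProjGenLinGroup.mk.comp ρ with hP
  set M : Subgroup (PGL(2, ZMod p)) := (P.comp Γ₁.subtype).range with hM
  have hPmem : ∀ σ ∈ Γ₁, P σ ∈ M := fun σ hσ ↦ ⟨⟨σ, hσ⟩, rfl⟩
  -- `H = {(P σ, P (θ σ)) : σ ∈ Γ₁} ≤ M × M`, with both projections onto
  let φ : Γ₁ →* M × M :=
    { toFun := fun σ ↦ (⟨P σ, hPmem σ σ.2⟩, ⟨P (θ σ), hPmem _ (hθmem σ σ.2)⟩)
      map_one' := by ext <;> simp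
      map_mul' := fun σ τ ↦ by ext <;> simp }
  have hφ1 : ∀ σ : Γ₁, ((φ σ).1 : PGL(2, ZMod p)) = P σ := fun _ ↦ rfl
  have hφ2 : ∀ σ : Γ₁, ((φ σ).2 : PGL(2, ZMod p)) = P (θ σ) := fun _ ↦ rfl
  set H : Subgroup (M × M) := φ.range with hH
  have h₁ : ∀ x : M, ∃ h ∈ H, h.1 = x := by
    rintro ⟨_, ⟨σ, rfl⟩⟩
    exact ⟨φ σ, ⟨σ, rfl⟩, rfl⟩
  have h₂ : ∀ y : M, ∃ h ∈ H, h.2 = y := by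
    rintro ⟨_, ⟨⟨σ₁, hσ₁⟩, rfl⟩⟩
    obtain ⟨σ, hσ, hθσ⟩ := hθsurj σ₁ hσ₁
    refine ⟨φ ⟨σ, hσ⟩, ⟨⟨σ, hσ⟩, rfl⟩, Subtype.ext ?_⟩
    simp only [hφ2, MonoidHom.comp_apply, Subgroup.subtype_apply, hθσ]
  -- `M` has a non-identity element of order prime to `p` (Serre, Prop. 15)
  have hirr' : ∀ (v : Fin 2 → ZMod p) (hv : v ≠ 0),
      ¬ (ρ.comp Γ₁.subtype).range ≤ eigenvectorStabilizer v hv :=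
    fun v hv ↦ not_range_le_eigenvectorStabilizer _ hirr v hv
  obtain ⟨_, ⟨σT, rfl⟩, hT1, hTp⟩ :=
    exists_projective_ne_one_not_dvd_orderOf hp2 (ρ.comp Γ₁.subtype).range hirr'
  set T : M := ⟨P σT, hPmem σT σT.2⟩ with hT
  have hTcoe : (T : PGL(2, ZMod p)) = Matrix.ProjGenLinGroup.mk ((ρ.comp Γ₁.subtype) σT) := rfl
  have hT1' : T ≠ 1 := fun h ↦ hT1 (by rw [← hTcoe, h]; rfl)
  have hTp' : ¬ p ∣ orderOf T := by
    rwa [← orderOf_injective M.subtype Subtype.coe_injective T]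
  -- the element `τ` (Goursat step) and regular semisimplicity of `ρ̄(τ)`, `ρ̄(θ τ)`
  obtain ⟨_, ⟨τ, rfl⟩, hx1, hx2, hxp1, hxp2⟩ :=
    exists_mem_fst_snd_ne_one_not_dvd_orderOf H h₁ h₂ hT1' hTp'
  refine ⟨τ, τ.2, ?_, ?_⟩
  · refine disc_ne_zero_of_projective hp2 (g := ρ τ) (fun h ↦ hx1 (Subtype.ext ?_)) ?_
    · rw [hφ1]; exact h
    · rwa [← orderOf_injective M.subtype Subtype.coe_injective (φ τ).1] at hxp1
  · refine disc_ne_zero_of_projective hp2 (g := ρ (θ τ)) (fun h ↦ hx2 (Subtype.ext ?_)) ?_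
    · rw [hφ2]; exact h
    · rwa [← orderOf_injective M.subtype Subtype.coe_injective (φ τ).2] at hxp2

end Heart

section Eigenvalues

open Polynomial

/-- **Non-zero discriminant means distinct eigenvalues**: for `g ∈ GL₂(k)` with
`tr(g)² - 4 det(g) ≠ 0` the eigenvalues of `g` in `k̄` (roots of the characteristic polynomial
`X² - tr(g) X + det(g)`, the tree's `eigenvalueMultiset` of `DecomposedGeneric`) are distinct:
a repeated root `a` is a root of the derivative `2X - tr(g)`, and then `tr² - 4 det = 0`.  (Any
characteristic; for the source, `k = 𝔽_p` with `p` odd, this is "regular semisimple".)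
[folklore] -/
theorem nodup_eigenvalueMultiset_of_disc_ne_zero {k : Type w} [Field k] (g : GL (Fin 2) k)
    (h : ((g : GL (Fin 2) k) : Matrix (Fin 2) (Fin 2) k).trace ^ 2 -
      4 * ((g : GL (Fin 2) k) : Matrix (Fin 2) (Fin 2) k).det ≠ 0) :
    (eigenvalueMultiset g).Nodup := by
  classical
  set ι := algebraMap k (AlgebraicClosure k) with hι
  set t : k := ((g : GL (Fin 2) k) : Matrix (Fin 2) (Fin 2) k).trace with ht
  set d : k := ((g : GL (Fin 2) k) : Matrix (Fin 2) (Fin 2) k).det with hd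
  set q : (AlgebraicClosure k)[X] := X ^ 2 - C (ι t) * X + C (ι d) with hq
  have hchar : (((g : GL (Fin 2) k) : Matrix (Fin 2) (Fin 2) k).charpoly).map ι = q := by
    rw [Matrix.charpoly_fin_two, hq, ht, hd]
    simp [Polynomial.map_sub, Polynomial.map_add, Polynomial.map_mul, Polynomial.map_pow]
  have hq0 : q ≠ 0 := by
    rw [← hchar]
    exact Polynomial.map_monic_ne_zero (Matrix.charpoly_monic _)
  rw [eigenvalueMultiset_def, hchar, Multiset.nodup_iff_count_le_one]
  intro a
  rw [count_roots]
  by_contra hlt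
  push Not at hlt
  obtain ⟨hr, hr'⟩ := (one_lt_rootMultiplicity_iff_isRoot hq0).1 hlt
  have hder : derivative q = C (2 : AlgebraicClosure k) * X - C (ι t) := by
    rw [hq]
    simp only [derivative_sub, derivative_add, derivative_X_pow, derivative_mul, derivative_C,
      derivative_X, zero_mul, mul_one, zero_add, add_zero, Nat.cast_ofNat]
    norm_num
  rw [IsRoot.def, hq, eval_add, eval_sub, eval_pow, eval_X, eval_mul, eval_C, eval_X, eval_C] at hr
  rw [IsRoot.def, hder, eval_sub, eval_mul, eval_C, eval_X, eval_C] at hr'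
  -- `2 a = t`, `a² - t a + d = 0` ⟹ `t² - 4 d = 0` in `k̄`, hence in `k`
  apply h
  apply ι.injective
  rw [map_sub, map_mul, map_pow, map_ofNat, map_zero]
  have ht' : ι t = 2 * a := by linear_combination -hr'
  rw [ht']
  linear_combination (-4 : AlgebraicClosure k) * hr + (4 * a) * hr'

/-- **Eigenvalues are conjugation invariant** (`charpoly (h g h⁻¹) = charpoly g`, Mathlib
`Matrix.charpoly_units_conj`); so the eigenvalue clause of `IsGenericAt` only depends on the
conjugacy class of `ρ̄(Frob)`. [folklore] -/
theorem eigenvalueMultiset_conj {k : Type w} [Field k] {n : ℕ} (h g : GL (Fin n) k) :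
    eigenvalueMultiset (h * g * h⁻¹) = eigenvalueMultiset g := by
  rw [eigenvalueMultiset_def, eigenvalueMultiset_def, Units.val_mul, Units.val_mul,
    Matrix.coe_units_inv, Matrix.charpoly_units_conj]

/-- The ratio clause "`α_i / α_j ≠ q`" of `IsGenericAt` is automatic when `q = 1` in `k̄` (it
reduces to `α_i ≠ α_j`): the case `l ≡ 1 mod p` of the source ("Since `l ≡ 1 mod p`, we have
shown that `l` is a decomposed generic prime for `ρ̄`"). [folklore] -/
theorem ne_mul_of_cast_eq_one {k : Type w} [Field k] {q : ℕ} (hq : (q : AlgebraicClosure k) = 1)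
    (s : Multiset (AlgebraicClosure k)) :
    ∀ a ∈ s, ∀ b ∈ s, a ≠ b → a ≠ (q : AlgebraicClosure k) * b := by
  intro a _ b _ hab
  rwa [hq, one_mul]

variable {p : ℕ} [Fact p.Prime]

/-- A rational prime (or any natural number) `l ≡ 1 mod p` is `1` in `𝔽̄_p`. [folklore] -/
theorem natCast_algebraicClosure_eq_one_of_modEq {l : ℕ} (hl : l ≡ 1 [MOD p]) :
    ((l : ℕ) : AlgebraicClosure (ZMod p)) = 1 := by
  have h1 : ((l : ℕ) : ZMod p) = 1 := by
    rw [← Nat.cast_one, ZMod.natCast_eq_natCast_iff]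
    exact hl
  rw [← map_natCast (algebraMap (ZMod p) (AlgebraicClosure (ZMod p))) l, h1, map_one]

/-- **Lemma 6.2.2, eigenvalue half of the conclusion.**  In the situation of
`exists_disc_ne_zero_and_disc_apply_ne_zero` (`ρ̄ : Γ →* GL₂(𝔽_p)`, `p` odd, irreducible on
`Γ₁`, `θ(Γ₁) = Γ₁`) and for any `l ≡ 1 mod p`, there is `τ ∈ Γ₁` such that every conjugate of
`ρ̄(τ)` and of `ρ̄(θ τ)` satisfies the eigenvalue clause of "`l` is decomposed generic for `ρ̄`"
([ACC⁺23, Def. 4.3.1], the second clause of the tree's `IsGenericAt` at a place `v ∣ l` with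
`q_v = l`): distinct eigenvalues `α₁ ≠ α₂` with `α_i ≠ l · α_j`.  In the source this is the last
paragraph of the proof: "`ρ̄(τ)` and `ρ̄(c⁻¹τc)` … are both regular semisimple elements of
`GL₂(𝔽_p)`. Since `l ≡ 1 mod p`, we have shown that `l` is a decomposed generic prime for `ρ̄`"
— granted Chebotarev's theorem, which makes the Frobenius elements at the places `v ∣ l` of `F`
the `G_F`-conjugates of `τ` and `c⁻¹τc` with `l` unramified (the first clause of `IsGenericAt`);
that step is `GaloisRepresentations/DecomposedGenericOfQuadratic` (with the proved
`chebotarev_artinRep_holds`). [cite: CaraianiNewton2023, Lemma 6.2.2 (proof, p. 91)] -/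
theorem exists_eigenvalue_generic_pair (hp2 : p ≠ 2)
    (ρ : Γ →* GL (Fin 2) (ZMod p)) (θ : Γ →* Γ) (Γ₁ : Subgroup Γ) (hθ : Γ₁.map θ = Γ₁)
    (hirr : (glRepresentation (ρ.comp Γ₁.subtype)).IsIrreducible) {l : ℕ} (hl : l ≡ 1 [MOD p]) :
    ∃ τ ∈ Γ₁, ∀ g ∈ ({ρ τ, ρ (θ τ)} : Set (GL (Fin 2) (ZMod p))), ∀ h : GL (Fin 2) (ZMod p),
      (eigenvalueMultiset (h * g * h⁻¹)).Nodup ∧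
        ∀ a ∈ eigenvalueMultiset (h * g * h⁻¹), ∀ b ∈ eigenvalueMultiset (h * g * h⁻¹),
          a ≠ b → a ≠ ((l : ℕ) : AlgebraicClosure (ZMod p)) * b := by
  obtain ⟨τ, hτ, h1, h2⟩ := exists_disc_ne_zero_and_disc_apply_ne_zero hp2 ρ θ Γ₁ hθ hirr
  refine ⟨τ, hτ, fun g hg h ↦ ?_⟩
  rw [eigenvalueMultiset_conj]
  refine ⟨?_, ne_mul_of_cast_eq_one (natCast_algebraicClosure_eq_one_of_modEq hl) _⟩
  rcases hg with rfl | rfl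
  · exact nodup_eigenvalueMultiset_of_disc_ne_zero _ h1
  · exact nodup_eigenvalueMultiset_of_disc_ne_zero _ h2

end Eigenvalues

end Literature.NumberTheory.GaloisRepresentations.CaraianiNewton
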